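import Mathlib
import Literature.Barriers.MatrixMultiplication.NormalizerBarrier
import Literature.NumberTheory.EllipticCurves.BinaryQuarticDiscriminantFpCountProofs

/-!
# Family A — an infinite family of non-Borel SubgroupTPP triples in `GL₂(𝔽_p)` of volume `2p(p-1)²`

Cell B2b-5 (route `LevelGradedCohnUmans`, crux `SubgroupIdentityDesigns`), generation 8.
VALUE = theorem (all primes `p ≠ 2`), NOT summit progress; it supports the crux without closing it.

The certified census of the cell `(m,k,p) = (2,1,11)` found 18 SubgroupTPP triples of volume
`2200 > 2000 = 2(p-1)^3` carrying a level-one identity design (`PassV2200.lean` kernel-certifies one).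
They come in two `GL₂(𝔽₁₁)`-families; this file isolates the GROUP-THEORETIC half of family (a) and
proves it for every odd prime `p`:

* `H₁ = {diag(1,t)}` (fixes `e₁`, scales `e₂`), `|H₁| = p - 1`;
* `H₂ = {1, r}` with the reflection `r = !![1,0;1,-1]` (`r e₂ = -e₂`, `r e₁ = e₁ + e₂`), `|H₂| = 2`;
* `H₃ = Stab(e₁ + e₂) = {g | g (1,1)ᵀ = (1,1)ᵀ}`, `|H₃| = p(p-1)`;

`(H₁, H₂, H₃)` satisfies the subgroup TPP, has NO common eigenvector (is contained in no Borel
subgroup), and its volume `(p-1) · 2 · p(p-1) = 2p(p-1)²` exceeds `2(p-1)^3`, the volume of the Borel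
family F of `BorelFamilyF.borelFamily_card` (the best Borel-type construction known; at `p = 11` the
largest volume `2000` of ANY Borel SubgroupTPP triple, by the gen-7 enumeration of the cell's ORACLE-g7
§G7-1), for every `p`.  It stays BELOW the proven Borel/toral ceiling `(p-1)^3 (2 + √p)` of
`BorelToralCeiling.borel_tpp_volume_le_sqrt` (`p = 11`: `2200 < 5316`), so it does not beat that
theorem; its point is that the best construction is not Borel.  Whether the triple carries a level-one
identity design for every `p` is NOT claimed in this file: it is kernel-certified at `p = 11`
(`PassV2200.exists_levelOne_design_volume_2200`, a conjugate of this configuration); the all-`p` design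
is the subject of the companion file `FamilyADesign`.
-/

set_option linter.dupNamespace false

open Literature.Barriers.MatrixMultiplication (SubgroupTPP)

namespace Summit.MatrixMultiplication.MatrixMultiplication.Theorems.SubgroupIdentityDesigns.Negative
namespace FamilyA

variable (p : ℕ) [Fact p.Prime]

local notation "GL₂" => Matrix.GeneralLinearGroup (Fin 2) (ZMod p)
local notation "M₂" => Matrix (Fin 2) (Fin 2) (ZMod p)

/-- The vector `w = e₁ + e₂ = (1,1)ᵀ`. -/
def w : Fin 2 → ZMod p := ![1, 1]

/-- `A.mulVec w` in coordinates. -/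
theorem mulVec_w (A : M₂) : A.mulVec (w p) = ![A 0 0 + A 0 1, A 1 0 + A 1 1] := by
  ext i; fin_cases i <;> simp [Matrix.mulVec, dotProduct, Fin.sum_univ_two, w]

/-- `H₁ = {diag(1,t) : t ≠ 0}`, cut out by three entry conditions. -/
def H₁ : Subgroup GL₂ where
  carrier := {g | (g : M₂) 0 0 = 1 ∧ (g : M₂) 0 1 = 0 ∧ (g : M₂) 1 0 = 0}
  one_mem' := by simp
  mul_mem' := by
    intro a b ha hb
    simp only [Set.mem_setOf_eq, Units.val_mul, Matrix.mul_apply, Fin.sum_univ_two] at ha hb ⊢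
    rw [ha.1, ha.2.1, ha.2.2, hb.1, hb.2.1, hb.2.2]; simp
  inv_mem' := by
    intro a ha
    simp only [Set.mem_setOf_eq] at ha ⊢
    have h : (a : M₂) * ((a⁻¹ : GL₂) : M₂) = 1 := by
      rw [← Units.val_mul, mul_inv_cancel, Units.val_one]
    have h' : ((a⁻¹ : GL₂) : M₂) * (a : M₂) = 1 := by
      rw [← Units.val_mul, inv_mul_cancel, Units.val_one]
    have e00 := congr_fun (congr_fun h 0) 0
    have e01 := congr_fun (congr_fun h 0) 1
    have e10 := congr_fun (congr_fun h' 1) 0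
    simp only [Matrix.mul_apply, Fin.sum_univ_two, Matrix.one_apply_eq, Matrix.one_apply_ne
      (show (0 : Fin 2) ≠ 1 by decide), Matrix.one_apply_ne (show (1 : Fin 2) ≠ 0 by decide),
      ha.1, ha.2.1, ha.2.2, one_mul, zero_mul, add_zero, mul_one, mul_zero] at e00 e01 e10
    exact ⟨e00, e01, e10⟩

/-- The reflection `r = !![1,0;1,-1]` (an involution). -/
def r : GL₂ :=
  ⟨!![1, 0; 1, -1], !![1, 0; 1, -1],
    by simp [Matrix.one_fin_two],
    by simp [Matrix.one_fin_two]⟩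

/-- The matrix of `r`. -/
theorem r_val : ((r p : GL₂) : M₂) = !![1, 0; 1, -1] := rfl

/-- `r` is an involution. -/
theorem r_mul_r : r p * r p = 1 := by
  apply Units.ext; simp [r, Matrix.one_fin_two]

/-- `r ≠ 1`. -/
theorem r_ne_one : r p ≠ 1 := by
  intro h
  have := congr_fun (congr_fun (congrArg (fun g : GL₂ => (g : M₂)) h) 1) 0
  simp [r] at this

/-- `H₂ = {1, r}`. -/
def H₂ : Subgroup GL₂ where
  carrier := {1, r p}
  one_mem' := by simp
  mul_mem' := by
    rintro a b (rfl | rfl) (rfl | rfl) <;> simp [r_mul_r]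
  inv_mem' := by
    rintro a (rfl | rfl)
    · simp
    · simp only [Set.mem_insert_iff, Set.mem_singleton_iff, inv_eq_one]
      right; rw [inv_eq_iff_mul_eq_one, r_mul_r]

/-- Membership in `H₂`. -/
theorem mem_H₂ {b : GL₂} : b ∈ H₂ p ↔ b = 1 ∨ b = r p := Iff.rfl

/-- `H₃ = Stab(w)`, `w = (1,1)ᵀ`. -/
def H₃ : Subgroup GL₂ where
  carrier := {g | (g : M₂).mulVec (w p) = w p}
  one_mem' := by simp only [Set.mem_setOf_eq, Units.val_one, Matrix.one_mulVec]
  mul_mem' := by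
    intro a b ha hb
    simp only [Set.mem_setOf_eq, Units.val_mul] at ha hb ⊢
    rw [← Matrix.mulVec_mulVec, hb, ha]
  inv_mem' := by
    intro a ha
    simp only [Set.mem_setOf_eq] at ha ⊢
    have h' : ((a⁻¹ : GL₂) : M₂) * (a : M₂) = 1 := by
      rw [← Units.val_mul, inv_mul_cancel, Units.val_one]
    calc ((a⁻¹ : GL₂) : M₂).mulVec (w p) = ((a⁻¹ : GL₂) : M₂).mulVec ((a : M₂).mulVec (w p)) := by
          rw [ha]
      _ = w p := by rw [Matrix.mulVec_mulVec, h', Matrix.one_mulVec]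

/-- Membership in `H₃`. -/
theorem mem_H₃ {g : GL₂} : g ∈ H₃ p ↔ (g : M₂).mulVec (w p) = w p := Iff.rfl

/-! ## Subgroup TPP -/

/-- The triple `(H₁, H₂, H₃)` satisfies the subgroup triple-product property, for every prime `p`. -/
theorem tpp : SubgroupTPP (H₁ p) (H₂ p) (H₃ p) := by
  intro a ha b hb g hg h
  obtain ⟨ha00, ha01, ha10⟩ := ha
  rw [mem_H₃] at hg
  have hab : ((a * b : GL₂) : M₂).mulVec (w p) = w p := by
    have h1 : ((a * b * g : GL₂) : M₂).mulVec (w p) = w p := by rw [h]; simp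
    rwa [Units.val_mul (a * b) g, ← Matrix.mulVec_mulVec, hg] at h1
  rcases (mem_H₂ p).1 hb with rfl | rfl
  · -- b = 1 : a w = w forces a = 1
    rw [mul_one, mulVec_w] at hab
    have e1 := congr_fun hab 1
    simp [w, ha10] at e1
    have ha1 : a = 1 := by
      apply Units.ext; ext i j
      fin_cases i <;> fin_cases j <;> simp [ha00, ha01, ha10, e1]
    subst ha1
    refine ⟨rfl, rfl, ?_⟩
    simpa using h
  · -- b = r : (a r) w = a (e₁) = (a₀₀, a₁₀) = (1, 0) ≠ w
    exfalso
    rw [Units.val_mul, ← Matrix.mulVec_mulVec, mulVec_w p (r p : M₂), r_val] at hab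
    have e1 := congr_fun hab 1
    simp [w, Matrix.mulVec, dotProduct, Fin.sum_univ_two, ha10] at e1

/-! ## No common eigenvector (the triple lies in no Borel subgroup) -/

/-- `u = !![2,-1;1,0] ∈ H₃` (its only eigenline is `⟨w⟩`). -/
def u : GL₂ :=
  ⟨!![2, -1; 1, 0], !![0, 1; -1, 2],
    by ext i j; fin_cases i <;> fin_cases j <;> simp [Matrix.mul_apply, Fin.sum_univ_two],
    by ext i j; fin_cases i <;> fin_cases j <;> simp [Matrix.mul_apply, Fin.sum_univ_two]⟩

/-- `u ∈ H₃`. -/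
theorem u_mem : u p ∈ H₃ p := by
  rw [mem_H₃, mulVec_w]; ext i; fin_cases i <;> simp [u, w]; ring

/-- `d = diag(1,-1) ∈ H₁`. -/
def d : GL₂ :=
  ⟨!![1, 0; 0, -1], !![1, 0; 0, -1], by simp [Matrix.one_fin_two], by simp [Matrix.one_fin_two]⟩

/-- `d ∈ H₁`. -/
theorem d_mem : d p ∈ H₁ p := by
  refine ⟨?_, ?_, ?_⟩ <;> simp [d]

/-- For `p ≠ 2` no nonzero vector is a common eigenvector of `H₁ ∪ H₂ ∪ H₃`: the three subgroups lie in
no common Borel subgroup of `GL₂(𝔽_p)` (witnesses `d ∈ H₁`, `u ∈ H₃`). -/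
theorem nonBorel (hp : p ≠ 2) :
    ∀ v : Fin 2 → ZMod p, v ≠ 0 → ∃ h : GL₂, (h ∈ H₁ p ∨ h ∈ H₂ p ∨ h ∈ H₃ p) ∧
      ∀ t : ZMod p, (h : M₂).mulVec v ≠ t • v := by
  intro v hv
  by_cases hu : ∀ t : ZMod p, ((u p : GL₂) : M₂).mulVec v ≠ t • v
  · exact ⟨u p, Or.inr (Or.inr (u_mem p)), hu⟩
  simp only [not_forall, not_not] at hu
  obtain ⟨t, ht⟩ := hu
  refine ⟨d p, Or.inl (d_mem p), fun s hs => hv ?_⟩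
  have h0 := congr_fun ht 0
  have h1 := congr_fun ht 1
  have k0 := congr_fun hs 0
  have k1 := congr_fun hs 1
  simp [u, d, Matrix.mulVec, dotProduct, Fin.sum_univ_two] at h0 h1 k0 k1
  -- h0 : 2 * v 0 - v 1 = t * v 0 ; h1 : v 0 = t * v 1 ; k0 : v 0 = s * v 0 ; k1 : -v 1 = s * v 1
  have e0 : v 0 * (1 - s) = 0 := by linear_combination k0
  have hv01 : v 0 = 0 ∧ v 1 = 0 := by
    rcases mul_eq_zero.1 e0 with h00 | hs1
    · have : t * v 1 = 0 := by rw [← h1, h00]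
      rcases mul_eq_zero.1 this with ht0 | hv1
      · refine ⟨h00, ?_⟩
        have := h0; rw [ht0, h00] at this; linear_combination -this
      · exact ⟨h00, hv1⟩
    · have hs : s = 1 := by linear_combination -hs1
      have : v 1 * 2 = 0 := by rw [hs] at k1; linear_combination -k1
      rcases mul_eq_zero.1 this with hv1 | h2
      · exact ⟨by rw [h1, hv1, mul_zero], hv1⟩
      · exact absurd h2 (Literature.NumberTheory.EllipticCurves.BinaryQuartic.two_ne_zero_zmod hp)
  ext i; fin_cases i
  · exact hv01.1
  · exact hv01.2

/-! ## Cardinalities: `|H₁| = p - 1`, `|H₂| = 2`, `|H₃| = p (p - 1)` -/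

/-- `diag(1,a)` as an element of `GL₂` (with `b = a⁻¹` supplied explicitly, to stay computable and
avoid the `ZMod`/`Units` inverse simp loop). -/
def diagU (a b : ZMod p) (hab : a * b = 1) (hba : b * a = 1) : GL₂ :=
  ⟨!![1, 0; 0, a], !![1, 0; 0, b],
    by rw [Matrix.mul_fin_two, Matrix.one_fin_two, hab]; simp,
    by rw [Matrix.mul_fin_two, Matrix.one_fin_two, hba]; simp⟩

/-- `H₁ ≃ (𝔽_p)ˣ` via the `(1,1)` entry. -/
def H₁equiv : H₁ p ≃ (ZMod p)ˣ where
  toFun g := ⟨(g.1 : M₂) 1 1, ((g.1⁻¹ : GL₂) : M₂) 1 1, by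
      have hg : (g.1 : M₂) 0 0 = 1 ∧ (g.1 : M₂) 0 1 = 0 ∧ (g.1 : M₂) 1 0 = 0 := g.2
      have h : (g.1 : M₂) * ((g.1⁻¹ : GL₂) : M₂) = 1 := by
        rw [← Units.val_mul, mul_inv_cancel, Units.val_one]
      have e := congr_fun (congr_fun h 1) 1
      simp only [Matrix.mul_apply, Fin.sum_univ_two, Matrix.one_apply_eq, hg.2.2, zero_mul,
        zero_add] at e
      exact e, by
      have hg : (g.1 : M₂) 0 0 = 1 ∧ (g.1 : M₂) 0 1 = 0 ∧ (g.1 : M₂) 1 0 = 0 := g.2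
      have h : ((g.1⁻¹ : GL₂) : M₂) * (g.1 : M₂) = 1 := by
        rw [← Units.val_mul, inv_mul_cancel, Units.val_one]
      have e := congr_fun (congr_fun h 1) 1
      simp only [Matrix.mul_apply, Fin.sum_univ_two, Matrix.one_apply_eq, hg.2.1, mul_zero,
        zero_add] at e
      exact e⟩
  invFun t := ⟨diagU p (t : ZMod p) ((t⁻¹ : (ZMod p)ˣ) : ZMod p) (Units.mul_inv t) (Units.inv_mul t),
      by
        show (!![1, 0; 0, (t : ZMod p)] : M₂) 0 0 = 1 ∧ (!![1, 0; 0, (t : ZMod p)] : M₂) 0 1 = 0 ∧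
          (!![1, 0; 0, (t : ZMod p)] : M₂) 1 0 = 0
        simp⟩
  left_inv g := by
    have hg : (g.1 : M₂) 0 0 = 1 ∧ (g.1 : M₂) 0 1 = 0 ∧ (g.1 : M₂) 1 0 = 0 := g.2
    apply Subtype.ext; apply Units.ext
    show (!![1, 0; 0, (g.1 : M₂) 1 1] : M₂) = (g.1 : M₂)
    ext i j; fin_cases i <;> fin_cases j
    · simpa using hg.1.symm
    · simpa using hg.2.1.symm
    · simpa using hg.2.2.symm
    · simp
  right_inv t := by
    apply Units.ext
    show (!![1, 0; 0, (t : ZMod p)] : M₂) 1 1 = (t : ZMod p)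
    simp

/-- `|H₁| = p - 1`. -/
theorem card_H₁ : Nat.card (H₁ p) = p - 1 := by
  rw [Nat.card_congr (H₁equiv p), Nat.card_eq_fintype_card, ZMod.card_units]

/-- `|H₂| = 2`. -/
theorem card_H₂ : Nat.card (H₂ p) = 2 := by
  change Nat.card (↥({1, r p} : Set GL₂)) = 2
  rw [Nat.card_coe_set_eq, Set.ncard_pair (r_ne_one p).symm]

/-- The elements of `H₃`: `!![1-b, b; 1-d, d]` with `b ≠ d` (determinant `d - b`). -/
def mkV (b d : ZMod p) (h : b ≠ d) : GL₂ :=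
  ⟨!![1 - b, b; 1 - d, d],
   !![(d - b)⁻¹ * d, -((d - b)⁻¹ * b); -((d - b)⁻¹ * (1 - d)), (d - b)⁻¹ * (1 - b)],
   by
    have hD : (d - b)⁻¹ * (d - b) = 1 := inv_mul_cancel₀ (sub_ne_zero.2 (Ne.symm h))
    have h00 : (1 - b) * ((d - b)⁻¹ * d) + b * (-((d - b)⁻¹ * (1 - d))) = 1 := by
      linear_combination hD
    have h01 : (1 - b) * (-((d - b)⁻¹ * b)) + b * ((d - b)⁻¹ * (1 - b)) = 0 := by ring
    have h10 : (1 - d) * ((d - b)⁻¹ * d) + d * (-((d - b)⁻¹ * (1 - d))) = 0 := by ring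
    have h11 : (1 - d) * (-((d - b)⁻¹ * b)) + d * ((d - b)⁻¹ * (1 - b)) = 1 := by
      linear_combination hD
    rw [Matrix.mul_fin_two, Matrix.one_fin_two, h00, h01, h10, h11],
   by
    have hD : (d - b)⁻¹ * (d - b) = 1 := inv_mul_cancel₀ (sub_ne_zero.2 (Ne.symm h))
    have h00 : (d - b)⁻¹ * d * (1 - b) + -((d - b)⁻¹ * b) * (1 - d) = 1 := by
      linear_combination hD
    have h01 : (d - b)⁻¹ * d * b + -((d - b)⁻¹ * b) * d = 0 := by ring
    have h10 : -((d - b)⁻¹ * (1 - d)) * (1 - b) + (d - b)⁻¹ * (1 - b) * (1 - d) = 0 := by ring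
    have h11 : -((d - b)⁻¹ * (1 - d)) * b + (d - b)⁻¹ * (1 - b) * d = 1 := by
      linear_combination hD
    rw [Matrix.mul_fin_two, Matrix.one_fin_two, h00, h01, h10, h11]⟩

/-- `H₃ ≃ {(b,d) ∈ 𝔽_p² : b ≠ d}` via the second column. -/
def H₃equiv : H₃ p ≃ {q : ZMod p × ZMod p // q.1 ≠ q.2} where
  toFun g := ⟨((g.1 : M₂) 0 1, (g.1 : M₂) 1 1), fun hq => by
      have hw := g.2
      rw [mem_H₃, mulVec_w] at hw
      have e0 := congr_fun hw 0
      have e1 := congr_fun hw 1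
      simp [w] at e0 e1
      have hdet : IsUnit (g.1 : M₂).det :=
        (Matrix.isUnit_iff_isUnit_det _).1 (Units.isUnit g.1)
      rw [Matrix.det_fin_two] at hdet
      apply hdet.ne_zero
      simp only at hq
      linear_combination ((g.1 : M₂) 1 1) * e0 - ((g.1 : M₂) 0 1) * e1 - hq⟩
  invFun q := ⟨mkV p q.1.1 q.1.2 q.2, by
      rw [mem_H₃, mulVec_w]; ext i; fin_cases i <;> simp [mkV, w]⟩
  left_inv g := by
    apply Subtype.ext; apply Units.ext
    have hw := g.2
    rw [mem_H₃, mulVec_w] at hw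
    have e0 := congr_fun hw 0
    have e1 := congr_fun hw 1
    simp [w] at e0 e1
    ext i j; fin_cases i <;> fin_cases j <;> simp [mkV]
    · linear_combination -e0
    · linear_combination -e1
  right_inv q := by apply Subtype.ext; simp [mkV]

/-- `|H₃| = p (p - 1)`. -/
theorem card_H₃ : Nat.card (H₃ p) = p * (p - 1) := by
  have e : {q : ZMod p × ZMod p // q.1 = q.2} ≃ ZMod p :=
    { toFun := fun q => q.1.1, invFun := fun a => ⟨(a, a), rfl⟩,
      left_inv := fun q => by
        obtain ⟨⟨a, b⟩, h⟩ := q; simp only at h; subst h; rfl,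
      right_inv := fun a => rfl }
  rw [Nat.card_congr (H₃equiv p), Nat.card_eq_fintype_card, Fintype.card_subtype_compl,
    Fintype.card_prod, Fintype.card_congr e, ZMod.card]
  exact (Nat.mul_sub_one p p).symm

/-- The volume `|H₁| |H₂| |H₃| = 2 p (p-1)²` beats `2 (p-1)^3`, the volume of the Borel family F
(`BorelFamilyF.borelFamily_card`), for `p ≥ 2`. -/
theorem volume_gt (hp2 : 2 ≤ p) : 2 * (p - 1) ^ 3 < (p - 1) * 2 * (p * (p - 1)) := by
  obtain ⟨q, rfl⟩ : ∃ q, p = q + 2 := ⟨p - 2, by omega⟩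
  have h1 : q + 2 - 1 = q + 1 := by omega
  rw [h1]
  have : (q + 1) * 2 * ((q + 2) * (q + 1)) = 2 * (q + 1) ^ 3 + 2 * (q + 1) ^ 2 := by ring
  rw [this]
  exact Nat.lt_add_of_pos_right (by positivity)

/-- **Family A.** For every prime `p ≠ 2` there are subgroups `H₁, H₂, H₃ ≤ GL₂(𝔽_p)` of orders
`p - 1`, `2`, `p (p - 1)` satisfying the subgroup TPP, contained in no common Borel subgroup (no common
eigenvector), of volume `2 p (p-1)² > 2 (p-1)^3` (the volume of the Borel family F,
`BorelFamilyF.borelFamily_card`; NOT the proven Borel ceiling `(p-1)^3(2+√p)` of `BorelToralCeiling`,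
under which this family stays).  At `p = 11` this is the configuration of the kernel-certified level-one
design `PassV2200` (volume 2200); the design half for general `p` is not claimed in this theorem. -/
theorem familyA (hp : p ≠ 2) : ∃ H₁ H₂ H₃ : Subgroup GL₂, SubgroupTPP H₁ H₂ H₃ ∧
    Nat.card H₁ = p - 1 ∧ Nat.card H₂ = 2 ∧ Nat.card H₃ = p * (p - 1) ∧
    2 * (p - 1) ^ 3 < Nat.card H₁ * Nat.card H₂ * Nat.card H₃ ∧
    ∀ v : Fin 2 → ZMod p, v ≠ 0 → ∃ h : GL₂, (h ∈ H₁ ∨ h ∈ H₂ ∨ h ∈ H₃) ∧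
      ∀ t : ZMod p, (h : M₂).mulVec v ≠ t • v :=
  ⟨H₁ p, H₂ p, H₃ p, tpp p, card_H₁ p, card_H₂ p, card_H₃ p, by
    rw [card_H₁, card_H₂, card_H₃]; exact volume_gt p (Nat.Prime.two_le Fact.out), nonBorel p hp⟩

end FamilyA
end Summit.MatrixMultiplication.MatrixMultiplication.Theorems.SubgroupIdentityDesigns.Negative
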